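import Literature.MathematicalPhysics.QuantumFieldTheory.Balaban1983to89.B10Eq27TorusAxialLog
import Literature.MathematicalPhysics.QuantumFieldTheory.Balaban1983to89.T3CruxEstimates
import Literature.MathematicalPhysics.QuantumFieldTheory.Balaban1983to89.T3DescentFibreTower
import Summits.QuantumFields.YangMills.Theorems.UnitScaleTiltProp8HalvingQuarterCubeSeq
import HarnessLib

/-!
# Route `UnitScaleTilt`, crux K1 child «MinimiserStabilityRegPr» (stmt-QuantumFields-19200), registered stub V2′ `stub_halvingStep`
# (skeletons v8 5b4e846794b80374 / v9 pen) — **THE NEAR SIZE (160) OF THE TOP-LEVEL DATUM OF [Balaban1985Variational] SECT. F, GAUGE-INVARIANTLY**: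
# for `U ∈ 𝔅_k(V)` with the (7)-datum `V` (`PlaqSmall ε₁ V`), the top average `W = Ū^{(k)}` has plaquettes within `ε₁` of `1`, so print's axial
# log datum `B(c) = (1/i)·log W(Γ_{y,c₋} ∪ c ∪ Γ_{c₊,y})` (lit-balaban r07's `B10Eq27TorusAxialLog.B27T` = [Balaban1985UV3] (27) — THE SAME OBJECT as the
# top-level `B` of (154)–(156)) obeys `‖B(c)‖ ≤ 2|c₋ − y|₁ε₁ ≤ 6·dist(c₋, y)·ε₁` and is Hermitian; delivered in the `hnear` currency of
# `HalvingQuarterCubeSeq.rows164_quarter_cubeSeqMT3` (distance `distBI(b, c) + r₀` from the evaluation bond `b`)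

Cell `ym3-torus` (HUMAN RULING D-0037, YM ladder rung R3 — continuum SU(2) YM₃ on the torus is a RUNG, not the Clay problem), width seat
`ym-ust-19200-w3` gen 2 (D-0149; H-map = w3 g0's `HALVING-SOCKET-w3g0-v2.md` §4 (d) «(160)/(155) data bounds at the carrier»).
`--supports stmt-QuantumFields-19200 --as helper`; def-free, 0 sorry, standard axioms.  Companion of `HalvingQuarterCubeSeq` (p591896).

THE PRINT ([Balaban1985Variational] p. 303): *«Now we use the assumption (7) for V, hence for V′. It implies that |V₁′(∂p) − 1| < ε₁ for
p ∈ Π″_k^{(k)} … It satisfies the generalized axial gauge conditions on Π^{(k)} with a center at the point y, hence |V₁′(x,x′) − 1| < |x − y|2L²ε₁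
for ⟨x,x′⟩ ⊂ Π^{(k)}. If ⟨x,x′⟩ ∈ Π″_k^{(k)}, then V₁′(x,x′) = V′(x,x′) = V″(x,x′) = V₁(x,x′) … Thus the above estimate implies that |B(x,x′)| <
|x − y|4L²ε₁. … Finally we have |B(x,x′)| < (8d²L² + 4L²|x − y|)ε₁ (160)»*; (154)–(156) p. 302: *«V₁ = e^{iB} … Q_j(ηA) = B on Λ′_j»*;
[Balaban1985UV3] p. 263 (27)–(28): *«B(c) = (1/i) log V(Γ_{y,c₋} ∪ c ∪ Γ_{c₊,y}) (27) … |B(c)| < 4L²|c₋ − y|g₀p(g₀) (28)»* — (27) IS the top-level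
datum of Sect. F read in the axial gauge centred at `y` ([Balaban1985UV3] p. 263 l. 1–4 «We apply the constructions and results of Sect. F [7]»).

WHAT THIS FILE PROVES (no definition, no sorry; `B27T`, `unitsField`, `toUField`, `rel`, `l1` = lit-balaban's letters, used BY NAME):
* §1 **`norm_B27T_le_of_plaqSmall`** — for EVERY `SU(2)`-valued configuration `W` of ANY torus of the tower with `PlaqSmall δ W` (`0 ≤ δ`) and every bond
  `c` with `|c₋ − y|₁·δ ≤ ½`: `‖B(c)‖ ≤ 2|c₋ − y|₁δ` (`B10Eq27TorusAxialLog.norm_B27T_le` on the box of half-width the period — under a GLOBAL plaquette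
  bound the box is immaterial); **`B27T_mem_selfAdjoint_of_plaqSmall`** — `B(c)` is Hermitian when `|c₋ − y|₁·δ ≤ ¼` (`𝔤`-valuedness).
  The datum of ANY axial representative `W^u` is `u(y)B(c)u(y)⁻¹` (`B27T_gaugeAct`), so the bounds hold for every gauge copy of `W` (print's `V′`, `V″`).
* §2 `l1_rel_le_d_mul_distSite` — `|x − y|₁ ≤ d·dist(x, y)` (`ℓ¹` length of the relative position vs. the sup circular distance `distSite` of the P2
  letters); hence **`norm_B27T_le_of_plaqSmall_dist`**: `‖B(c)‖ ≤ 2d·dist(c₋, y)·δ` under `2d·dist(c₋, y)·δ ≤ 1` (d = 3: `6·dist·δ`).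
* §3 AT THE d = 3 CARRIER (`k = K − n`): **`plaqSmall_iterTop_of_mem_fibre`** — `U ∈ fibre V ∧ PlaqSmall ε₁ V ⇒ PlaqSmall ε₁ Ū^{(k)}` (the top average
  IS `V` read on the `K`-tower, `T3CruxEstimates.plaqSmall_fieldShift`); **`norm_datum160_le`** — for `U ∈ fibre V`, `PlaqSmall ε₁ V`, `0 ≤ ε₁`, centre
  `y`, and a top-level bond `c` with `6·dist(c₋, y)·ε₁ ≤ ½`: `‖B_{Ū^{(k)}}(c)‖ ≤ 6·dist(c₋, y)·ε₁` and `B(c)` Hermitian — print's (160) with the constant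
  `6` in place of `8d²L² + 4L²` (the tree's single top level has no `□′_k`, so [Balaban1985RegularSpaces] Lemma 1 is not needed and the comb-fan
  Stokes bound has no `L²`).
* §4 THE `hnear` CURRENCY of `HalvingQuarterCubeSeq.rows164_quarter_cubeSeqMT3`: `dist_le_distBI_add` — for a top-level index bond `c` of
  `cubeSeqMT3 F n K x₀ ρ S M` and a fine bond `b` whose `k`-block is within `r₀` of the centre block, `dist(c₋, c_k) ≤ distBI(b, c) + r₀`;
  **`hnear_of_topFamily`** — a bound `|X_k(e)| ≤ β·(dist(e₋, c_k) + 1)` for a level-indexed family `X_j : PBond (F.P K) j → ℝ` at `j = k` yields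
  `|X_{j(c)}(c)| ≤ β(r₀ + 1)·(distBI(b,c) + 1)` for every top-level index bond — the `hnear` hypothesis verbatim with `C·M_Δ·ε₁ := β(r₀ + 1)`;
  **`hnear_datum160`** — the two composed: any real functional `φ` of the datum with `|φ A| ≤ ‖A‖` (a `𝔤`-component) gives a near datum of size
  `C·M_Δ·ε₁ = 6(r₀ + 1)·ε₁`.
HONEST SCOPE: the identification «the datum fed to `H` at a top-level interior index bond IS `B_{V″}(c)`» ((154) first case, [Balaban1985RegularSpaces]
(1.31) first case: `u`-free because `R₀u = 1` on `Λ_k`) belongs to the chart construction (pillar P1, [Balaban1985RegularSpaces] Thm 2 on the cube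
sequence) and is NOT proved here; boundary-crossing top-level bonds ((1.31) second case) carry a `u`-rotation and are to be treated with the far
size at distance `≥ ρ − r₀ − 1` (`HalvingQuarterCubeSeq.distBI_ge_of_level_lt`'s sibling, not needed yet).  NOT a claim about the crux, the rung,
or the mass gap.

References: T. Bałaban, CMP **102** (1985) 277–309 [Balaban1985Variational] (7) p.278, (154)–(156) p.302, (160)–(161) p.303; CMP **102** (1985)
255–275 [Balaban1985UV3] (27)–(28) p.263; CMP **98** (1985) 17–51 [Balaban1985Averaging] pp.24–25; CMP **99** (1985) 75–102 [Balaban1985RegularSpaces]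
(1.31) p.82, Lemma 1 p.79.
-/

set_option autoImplicit false

noncomputable section

open scoped BigOperators Matrix.Norms.L2Operator

namespace Summit.QuantumFields.YangMills.Theorems.HalvingDatum160

open Literature.MathematicalPhysics.QuantumFieldTheory.Balaban1983to89
open Literature.MathematicalPhysics.QuantumFieldTheory.Balaban1983to89.T3ContinuumYM3Torus
open Literature.MathematicalPhysics.QuantumFieldTheory.Balaban1983to89.T3UnitLawDensityEML (ℰp)
open Literature.MathematicalPhysics.QuantumFieldTheory.Balaban1983to89.T3ConstrainedMinimiser (fibre)
open Literature.MathematicalPhysics.QuantumFieldTheory.Balaban1983to89.T3DescentFibreTower (mem_fibre_iff)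
open B10Eq27TorusAxialLog (B27T unitsField toUField rel transl norm_B27T_le B27T_mem_selfAdjoint h13_unitsField unitsField_mem_unitaryUnits
  U1_of_unitaryUnits dist1_plaqHol_toUField natAbs_rel_le)
open B7Prop1Explicit (l1 e)
open B7Prop1Local (InBox PlaqIn)
open B5Eq117TorusCarriers (Mk)
open B5Eq118OneStroke (iterBlockOf)
open B5Prop12FieldsLattice (distSite distSite_nonneg)
open B5RowSumsP12Lattice (distSite_comm distSite_triangle)
open B6SectADomainsV1 (Domains)
open B6SectAOperatorsV1 (BondIdx)
open FlatCubeOpsText (distBI)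
open FlatCubeSequenceAligned (cubeSeqMT3)

/-! ## §1 The axial log datum of a configuration with small plaquettes: norm bound and Hermiticity -/

section Torus

variable {P : Params} {j : ℕ}

/-- The box of half-width the period around the centre: every relative position lies in it, with room for one more step. [folklore] -/
theorem inBox_period (y x : Site P j) :
    InBox (fun _ => -((P.sitesPerDir j : ℕ) : ℤ)) (fun _ => ((P.sitesPerDir j : ℕ) : ℤ)) (rel y x) := by
  intro i
  dsimp only
  have h := natAbs_rel_le y x i
  have h2 : (((rel y x i).natAbs : ℕ) : ℤ) ≤ ((P.sitesPerDir j / 2 : ℕ) : ℤ) := by exact_mod_cast h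
  rw [Int.natCast_natAbs] at h2
  obtain ⟨h3, h4⟩ := abs_le.mp h2
  have hN : ((P.sitesPerDir j / 2 : ℕ) : ℤ) ≤ ((P.sitesPerDir j : ℕ) : ℤ) := by exact_mod_cast Nat.div_le_self _ _
  constructor <;> omega

/-- … and the shifted relative position `(x − y) + e_μ` lies in it too. [folklore] -/
theorem inBox_period_add_e (y x : Site P j) (μ : Fin P.d) :
    InBox (fun _ => -((P.sitesPerDir j : ℕ) : ℤ)) (fun _ => ((P.sitesPerDir j : ℕ) : ℤ)) (rel y x + e μ) := by
  intro i
  dsimp only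
  have h := natAbs_rel_le y x i
  have h2 : (((rel y x i).natAbs : ℕ) : ℤ) ≤ ((P.sitesPerDir j / 2 : ℕ) : ℤ) := by exact_mod_cast h
  rw [Int.natCast_natAbs] at h2
  obtain ⟨h3, h4⟩ := abs_le.mp h2
  have hN1 : 1 ≤ P.sitesPerDir j := Nat.one_le_iff_ne_zero.mpr (P.sitesPerDir_ne_zero j)
  have hN : ((P.sitesPerDir j / 2 : ℕ) : ℤ) + 1 ≤ ((P.sitesPerDir j : ℕ) : ℤ) := by
    have : P.sitesPerDir j / 2 + 1 ≤ P.sitesPerDir j := by omega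
    exact_mod_cast this
  have he : (e μ : B7Prop1Explicit.Site P.d) i = if i = μ then 1 else 0 := by
    simp [e, Pi.single_apply]
  rw [Pi.add_apply, he]
  split_ifs <;> constructor <;> omega

/-- `0` lies in the box. [folklore] -/
theorem inBox_period_zero (P : Params) (j : ℕ) :
    InBox (fun _ => -((P.sitesPerDir j : ℕ) : ℤ)) (fun _ => ((P.sitesPerDir j : ℕ) : ℤ)) (0 : B7Prop1Explicit.Site P.d) := by
  intro i
  constructor <;> simp

/-- **THE NEAR SIZE, GENERIC TORUS FORM** ([Balaban1985UV3] (28) ∕ [Balaban1985Variational] (160), first member): an `SU(2)`-valued configuration `W` of a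
torus of the tower with ALL plaquette variables within `δ` of `1` has axial log datum `‖B(c)‖ = ‖(1/i) log W(Γ_{y,c₋} ∪ c ∪ Γ_{c₊,y})‖ ≤ 2|c₋ − y|₁δ`
on every bond `c` with `|c₋ − y|₁δ ≤ ½`. [cite: Balaban1985UV3, (27)-(28) p.263; Balaban1985Variational, (160) p.303; Balaban1985Averaging, pp.24-25] -/
theorem norm_B27T_le_of_plaqSmall (W : GaugeField P j (Matrix.specialUnitaryGroup (Fin 2) ℂ)) {δ : ℝ} (hδ : 0 ≤ δ) (hW : PlaqSmall δ W)
    (y : Site P j) (c : PBond P j) (hsmall : (l1 (rel y c.src) : ℝ) * δ ≤ 1 / 2) :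
    ‖B27T (unitsField (toUField W)) y c‖ ≤ 2 * ((l1 (rel y c.src) : ℝ) * δ) := by
  letI : CStarAlgebra (Matrix (Fin 2) (Fin 2) ℂ) := B10Eq29TubeLine.cstarAlgebraMatrix 2
  have hlohi : ∀ i : Fin P.d, (fun _ : Fin P.d => -((P.sitesPerDir j : ℕ) : ℤ)) i ≤ (fun _ => ((P.sitesPerDir j : ℕ) : ℤ)) i :=
    fun i => by dsimp only; omega
  have h13 := h13_unitsField (lo := fun _ => -((P.sitesPerDir j : ℕ) : ℤ)) (hi := fun _ => ((P.sitesPerDir j : ℕ) : ℤ))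
    (toUField W) y (α := δ) (fun z κ μ hκμ _ => by rw [dist1_plaqHol_toUField]; exact (hW _).le)
  have hV := U1_of_unitaryUnits (unitsField_mem_unitaryUnits (toUField W))
  exact norm_B27T_le hlohi (unitsField (toUField W)) hV y h13 hδ (inBox_period_zero P j) c (inBox_period y c.src)
    (inBox_period_add_e y c.src c.dir) hsmall

/-- **THE DATUM IS `𝔤`-VALUED**: under the same hypotheses with `|c₋ − y|₁δ ≤ ¼`, `B(c)` is a Hermitian matrix. [cite: Balaban1985UV3, (27) p.263;
Balaban1985Variational, (156) p.302] -/
theorem B27T_mem_selfAdjoint_of_plaqSmall (W : GaugeField P j (Matrix.specialUnitaryGroup (Fin 2) ℂ)) {δ : ℝ} (hδ : 0 ≤ δ)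
    (hW : PlaqSmall δ W) (y : Site P j) (c : PBond P j) (hsmall : (l1 (rel y c.src) : ℝ) * δ ≤ 1 / 4) :
    B27T (unitsField (toUField W)) y c ∈ selfAdjoint (Matrix (Fin 2) (Fin 2) ℂ) := by
  letI : CStarAlgebra (Matrix (Fin 2) (Fin 2) ℂ) := B10Eq29TubeLine.cstarAlgebraMatrix 2
  have hlohi : ∀ i : Fin P.d, (fun _ : Fin P.d => -((P.sitesPerDir j : ℕ) : ℤ)) i ≤ (fun _ => ((P.sitesPerDir j : ℕ) : ℤ)) i :=
    fun i => by dsimp only; omega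
  have h13 := h13_unitsField (lo := fun _ => -((P.sitesPerDir j : ℕ) : ℤ)) (hi := fun _ => ((P.sitesPerDir j : ℕ) : ℤ))
    (toUField W) y (α := δ) (fun z κ μ hκμ _ => by rw [dist1_plaqHol_toUField]; exact (hW _).le)
  exact B27T_mem_selfAdjoint hlohi (unitsField_mem_unitaryUnits (toUField W)) y h13 hδ (inBox_period_zero P j) c
    (inBox_period y c.src) (inBox_period_add_e y c.src c.dir) hsmall

/-! ## §2 `ℓ¹` length of the relative position vs. the sup circular distance -/

/-- **`|x − y|₁ ≤ d·dist(x, y)`**: the `ℓ¹` length of the relative position (least-absolute-value representatives) is at most `d` times the sup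
circular distance `distSite` of the P2 letters. [folklore] -/
theorem l1_rel_le_d_mul_distSite (y x : Site P j) : (l1 (rel y x) : ℝ) ≤ (P.d : ℝ) * distSite (Mk P j) x y := by
  have hv : ∀ κ, 2 * (((rel y x) κ).natAbs : ℝ) ≤ 2 * distSite (Mk P j) x y := by
    intro κ
    have h : ((rel y x) κ).natAbs ≤ Finset.univ.sup fun μ : Fin P.d => ((x μ - y μ).valMinAbs).natAbs :=
      Finset.le_sup (f := fun μ : Fin P.d => ((x μ - y μ).valMinAbs).natAbs) (Finset.mem_univ κ)
    have hcast := (Nat.cast_le (α := ℝ)).2 h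
    unfold distSite
    linarith
  have h2 := B10Eq27AxialLog.two_mul_l1_le_real hv
  linarith

/-- **THE NEAR SIZE IN THE DISTANCE LETTER**: `‖B(c)‖ ≤ 2d·dist(c₋, y)·δ` whenever `2d·dist(c₋, y)·δ ≤ 1`. [cite: Balaban1985Variational, (160) p.303;
Balaban1985UV3, (28) p.263] -/
theorem norm_B27T_le_of_plaqSmall_dist (W : GaugeField P j (Matrix.specialUnitaryGroup (Fin 2) ℂ)) {δ : ℝ} (hδ : 0 ≤ δ) (hW : PlaqSmall δ W)
    (y : Site P j) (c : PBond P j) (hsmall : 2 * (P.d : ℝ) * distSite (Mk P j) c.src y * δ ≤ 1) :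
    ‖B27T (unitsField (toUField W)) y c‖ ≤ 2 * (P.d : ℝ) * distSite (Mk P j) c.src y * δ := by
  have hl := l1_rel_le_d_mul_distSite y c.src
  have hl' : (l1 (rel y c.src) : ℝ) * δ ≤ (P.d : ℝ) * distSite (Mk P j) c.src y * δ := mul_le_mul_of_nonneg_right hl hδ
  have h := norm_B27T_le_of_plaqSmall W hδ hW y c (by linarith)
  linarith

/-- … and Hermitian whenever `4d·dist(c₋, y)·δ ≤ 1`. [cite: Balaban1985Variational, (156) p.302; Balaban1985UV3, (27) p.263] -/
theorem B27T_mem_selfAdjoint_of_plaqSmall_dist (W : GaugeField P j (Matrix.specialUnitaryGroup (Fin 2) ℂ)) {δ : ℝ} (hδ : 0 ≤ δ)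
    (hW : PlaqSmall δ W) (y : Site P j) (c : PBond P j) (hsmall : 4 * (P.d : ℝ) * distSite (Mk P j) c.src y * δ ≤ 1) :
    B27T (unitsField (toUField W)) y c ∈ selfAdjoint (Matrix (Fin 2) (Fin 2) ℂ) := by
  have hl := l1_rel_le_d_mul_distSite y c.src
  have hl' : (l1 (rel y c.src) : ℝ) * δ ≤ (P.d : ℝ) * distSite (Mk P j) c.src y * δ := mul_le_mul_of_nonneg_right hl hδ
  exact B27T_mem_selfAdjoint_of_plaqSmall W hδ hW y c (by linarith)

end Torus

/-! ## §3 At the d = 3 carrier: the top average of a configuration of the fibre -/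

section Carrier

variable (F : T3Family) {n K : ℕ} (hnK : n ≤ K)

/-- **THE TOP AVERAGE OF `U ∈ 𝔅_k(V)` HAS THE PLAQUETTES OF `V`**: `U ∈ fibre V ∧ PlaqSmall ε₁ V ⇒ PlaqSmall ε₁ Ū^{(K−n)}` — the `(K−n)`-fold (0.4)-average
of `U` IS `V` read on the `K`-th tower (`descendTo = fieldShift ∘ iter`, `T3CruxEstimates.plaqSmall_fieldShift`). [cite: Balaban1985Variational, (3) p.278,
(7) p.278; Balaban1987RG1, (0.11) p.253] -/
theorem plaqSmall_iterTop_of_mem_fibre {ε₁ : ℝ} {V : GaugeField (F.P n) 0 (Matrix.specialUnitaryGroup (Fin 2) ℂ)}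
    {U : GaugeField (F.P K) 0 (Matrix.specialUnitaryGroup (Fin 2) ℂ)} (hU : U ∈ fibre F ℰp n K hnK V) (hV : PlaqSmall ε₁ V) :
    PlaqSmall ε₁ (Averaging.iter (fun i => BlockAveraging.blockAvg (P := F.P K) (j := i) ℰp) (K - n) U) := by
  rw [mem_fibre_iff] at hU
  rw [← hU] at hV
  exact (T3CruxEstimates.plaqSmall_fieldShift F
    (F.sitesPerDir_eq (m := F.m) (K := n) (j := 0) (m' := F.m) (K' := K) (j' := K - n) (by omega)) ε₁
    (Averaging.iter (fun i => BlockAveraging.blockAvg (P := F.P K) (j := i) ℰp) (K - n) U)).1 hV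

/-- **(160) AT THE CARRIER, FIRST MEMBER, GAUGE-INVARIANT FORM** (d = 3): for `U ∈ fibre V` over a (7)-datum `V` (`PlaqSmall ε₁ V`, `0 ≤ ε₁`), a centre
`y` of the top torus and a top-level bond `c` with `6·dist(c₋, y)·ε₁ ≤ ½`, the axial log datum of the top average satisfies
`‖B_{Ū^{(k)}}(c)‖ ≤ 6·dist(c₋, y)·ε₁` and is Hermitian.  (Print: `|B(x,x′)| < (8d²L² + 4L²|x − y|)ε₁`; the datum of any gauge copy `W^u` of the top
average is `u(y)Bu(y)⁻¹`, `B10Eq27TorusAxialLog.B27T_gaugeAct`.) [cite: Balaban1985Variational, (160) p.303, (7) p.278; Balaban1985UV3, (27)-(28) p.263] -/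
theorem norm_datum160_le {ε₁ : ℝ} (hε₁ : 0 ≤ ε₁) {V : GaugeField (F.P n) 0 (Matrix.specialUnitaryGroup (Fin 2) ℂ)}
    {U : GaugeField (F.P K) 0 (Matrix.specialUnitaryGroup (Fin 2) ℂ)} (hU : U ∈ fibre F ℰp n K hnK V) (hV : PlaqSmall ε₁ V)
    (y : Site (F.P K) (K - n)) (c : PBond (F.P K) (K - n)) (hsmall : 6 * distSite (Mk (F.P K) (K - n)) c.src y * ε₁ ≤ 1 / 2) :
    ‖B27T (unitsField (toUField (Averaging.iter (fun i => BlockAveraging.blockAvg (P := F.P K) (j := i) ℰp) (K - n) U))) y c‖ ≤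
        6 * distSite (Mk (F.P K) (K - n)) c.src y * ε₁ ∧
      B27T (unitsField (toUField (Averaging.iter (fun i => BlockAveraging.blockAvg (P := F.P K) (j := i) ℰp) (K - n) U))) y c ∈
        selfAdjoint (Matrix (Fin 2) (Fin 2) ℂ) := by
  have hW := plaqSmall_iterTop_of_mem_fibre F hnK hU hV
  have hd : ((F.P K).d : ℝ) = 3 := by rw [T3Family.P_d]; norm_num
  have hdist : 0 ≤ distSite (Mk (F.P K) (K - n)) c.src y := distSite_nonneg _ _
  refine ⟨?_, ?_⟩
  · have h := norm_B27T_le_of_plaqSmall_dist _ hε₁ hW y c (by rw [hd]; nlinarith)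
    rw [hd] at h
    linarith
  · exact B27T_mem_selfAdjoint_of_plaqSmall_dist _ hε₁ hW y c (by rw [hd]; nlinarith)

end Carrier

/-! ## §4 The `hnear` currency of `HalvingQuarterCubeSeq.rows164_quarter_cubeSeqMT3` -/

section Near

variable {F : T3Family} {n K : ℕ}

/-- **FROM THE CENTRE TO THE EVALUATION BOND**: for a top-level index bond `c` of `cubeSeqMT3 F n K x₀ ρ S M` and a fine bond `b` whose `k`-block is within `r₀`
of the centre block `c_k = B^k(x₀)`: `dist(c₋, c_k) ≤ distBI(b, c) + r₀` (at the top level `distBI(b, c) = dist(B^k b₋, c₋)`; triangle inequality — print's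
«|x − y| ≤ d(y₁, c₋) + O(M_Δ)» behind the `(d(y₁,y₂) + 1)` of (161)). [cite: Balaban1985Variational, (161) p.303] -/
theorem dist_le_distBI_add (x₀ : Site (F.P K) 0) (ρ S M : ℕ) (hM : 1 ≤ M) (c : BondIdx (cubeSeqMT3 F n K x₀ ρ S M hM))
    (hc : (c.1.1 : ℕ) = K - n) {b : PBond (F.P K) 0} {r₀ : ℝ}
    (hb : distSite (Mk (F.P K) (K - n)) (iterBlockOf (K - n) b.src) (iterBlockOf (K - n) x₀) ≤ r₀) :
    distSite (Mk (F.P K) (c.1.1 : ℕ)) c.1.2.src (iterBlockOf (c.1.1 : ℕ) x₀) ≤ distBI (cubeSeqMT3 F n K x₀ ρ S M hM) b c + r₀ := by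
  -- generalise the level of `c` to a variable and substitute `j = K − n`
  obtain ⟨⟨j, e⟩, hlam⟩ := c
  change (j : ℕ) = K - n at hc
  unfold distBI
  simp only
  -- at the top level the normalising power is `1`
  have hk0 : (cubeSeqMT3 F n K x₀ ρ S M hM).k - (j : ℕ) = 0 := by
    show (K - n) - (j : ℕ) = 0
    omega
  rw [hk0, pow_zero, one_mul]
  -- the triangle inequality at level `j = K − n`
  have key : ∀ (i : ℕ) (hi : i = K - n) (e' : PBond (F.P K) i),
      distSite (Mk (F.P K) i) e'.src (iterBlockOf i x₀) ≤ distSite (Mk (F.P K) i) (iterBlockOf i b.src) e'.src + r₀ := by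
    intro i hi e'
    subst hi
    have htri := distSite_triangle (Mk (F.P K) (K - n)) e'.src (iterBlockOf (K - n) b.src) (iterBlockOf (K - n) x₀)
    rw [distSite_comm (Mk (F.P K) (K - n)) e'.src (iterBlockOf (K - n) b.src)] at htri
    linarith
  exact key (j : ℕ) hc e

/-- **A LEVEL-INDEXED FAMILY BOUND AT THE TOP LEVEL GIVES `hnear`**: if `X_j : PBond (F.P K) j → ℝ` satisfies `|X_k(e)| ≤ β·(dist(e₋, c_k) + 1)` at `j = k`
(`0 ≤ β`), then for every top-level index bond `c` and every fine bond `b` within `r₀ ≥ 0` blocks of the centre: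
`|X_{j(c)}(c)| ≤ β(r₀ + 1)·(distBI(b, c) + 1)` — the near hypothesis of `rows164_quarter_cubeSeqMT3` with `C·M_Δ·ε₁ := β(r₀ + 1)`.
[cite: Balaban1985Variational, (160)-(161) p.303] -/
theorem hnear_of_topFamily (x₀ : Site (F.P K) 0) (ρ S M : ℕ) (hM : 1 ≤ M) {β r₀ : ℝ} (hβ : 0 ≤ β) (hr₀ : 0 ≤ r₀)
    (X : (j : ℕ) → PBond (F.P K) j → ℝ)
    (hX : ∀ e : PBond (F.P K) (K - n), |X (K - n) e| ≤ β * (distSite (Mk (F.P K) (K - n)) e.src (iterBlockOf (K - n) x₀) + 1))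
    {b : PBond (F.P K) 0} (hb : distSite (Mk (F.P K) (K - n)) (iterBlockOf (K - n) b.src) (iterBlockOf (K - n) x₀) ≤ r₀) :
    ∀ c : BondIdx (cubeSeqMT3 F n K x₀ ρ S M hM), (c.1.1 : ℕ) = K - n →
      |X (c.1.1 : ℕ) c.1.2| ≤ β * (r₀ + 1) * (distBI (cubeSeqMT3 F n K x₀ ρ S M hM) b c + 1) := by
  intro c hc
  have hd := dist_le_distBI_add x₀ ρ S M hM c hc hb
  have hD := HalvingQuarterCubeSeq.distBI_nonneg (cubeSeqMT3 F n K x₀ ρ S M hM) b c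
  -- the family bound at the level of `c`
  have key : ∀ (i : ℕ) (hi : i = K - n) (e' : PBond (F.P K) i),
      |X i e'| ≤ β * (distSite (Mk (F.P K) i) e'.src (iterBlockOf i x₀) + 1) := by
    intro i hi e'
    subst hi
    exact hX e'
  have h1 := key (c.1.1 : ℕ) hc c.1.2
  have h2 : distSite (Mk (F.P K) (c.1.1 : ℕ)) c.1.2.src (iterBlockOf (c.1.1 : ℕ) x₀) + 1 ≤
      distBI (cubeSeqMT3 F n K x₀ ρ S M hM) b c + r₀ + 1 := by linarith
  have h3 := mul_le_mul_of_nonneg_left h2 hβ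
  have h4 : β * (distBI (cubeSeqMT3 F n K x₀ ρ S M hM) b c + r₀ + 1) ≤
      β * (r₀ + 1) * (distBI (cubeSeqMT3 F n K x₀ ρ S M hM) b c + 1) := by
    have h5 : 0 ≤ β * r₀ * distBI (cubeSeqMT3 F n K x₀ ρ S M hM) b c := mul_nonneg (mul_nonneg hβ hr₀) hD
    nlinarith
  exact h1.trans (h3.trans h4)

/-- **THE NEAR DATUM OF (161) FROM (160), COMPOSED** (d = 3): for `U ∈ fibre V`, `PlaqSmall ε₁ V`, `0 ≤ ε₁`, a real functional `φ` of the `2 × 2` matrices with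
`|φ A| ≤ ‖A‖` (a `𝔤`-component), a level-indexed family `X` whose top member is `X_k(e) = φ(B_{Ū^{(k)}}(e))` on the bonds with `6·dist(e₋, c_k)·ε₁ ≤ ½` (print's
regime: `dist ≤` the cube radius, `O(1)R₁M₁ε₁` small) and is otherwise bounded by `6ε₁(dist + 1)` there too (e.g. `0` outside), and a fine bond `b`
within `r₀ ≥ 0` blocks of the centre: the near hypothesis holds with `C·M_Δ·ε₁ = 6ε₁(r₀ + 1)`. [cite: Balaban1985Variational, (160)-(161) p.303] -/
theorem hnear_datum160 (hnK : n ≤ K) (x₀ : Site (F.P K) 0) (ρ S M : ℕ) (hM : 1 ≤ M) {ε₁ r₀ : ℝ} (hε₁ : 0 ≤ ε₁) (hr₀ : 0 ≤ r₀)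
    {V : GaugeField (F.P n) 0 (Matrix.specialUnitaryGroup (Fin 2) ℂ)} {U : GaugeField (F.P K) 0 (Matrix.specialUnitaryGroup (Fin 2) ℂ)}
    (hU : U ∈ fibre F ℰp n K hnK V) (hV : PlaqSmall ε₁ V)
    (φ : Matrix (Fin 2) (Fin 2) ℂ → ℝ) (hφ : ∀ A, |φ A| ≤ ‖A‖)
    (X : (j : ℕ) → PBond (F.P K) j → ℝ)
    (hX : ∀ e : PBond (F.P K) (K - n), 6 * distSite (Mk (F.P K) (K - n)) e.src (iterBlockOf (K - n) x₀) * ε₁ ≤ 1 / 2 →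
      X (K - n) e = φ (B27T (unitsField (toUField (Averaging.iter (fun i => BlockAveraging.blockAvg (P := F.P K) (j := i) ℰp) (K - n) U)))
        (iterBlockOf (K - n) x₀) e))
    (hX' : ∀ e : PBond (F.P K) (K - n), ¬ 6 * distSite (Mk (F.P K) (K - n)) e.src (iterBlockOf (K - n) x₀) * ε₁ ≤ 1 / 2 →
      |X (K - n) e| ≤ 6 * ε₁ * (distSite (Mk (F.P K) (K - n)) e.src (iterBlockOf (K - n) x₀) + 1))
    {b : PBond (F.P K) 0} (hb : distSite (Mk (F.P K) (K - n)) (iterBlockOf (K - n) b.src) (iterBlockOf (K - n) x₀) ≤ r₀) :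
    ∀ c : BondIdx (cubeSeqMT3 F n K x₀ ρ S M hM), (c.1.1 : ℕ) = K - n →
      |X (c.1.1 : ℕ) c.1.2| ≤ 6 * ε₁ * (r₀ + 1) * (distBI (cubeSeqMT3 F n K x₀ ρ S M hM) b c + 1) := by
  refine hnear_of_topFamily x₀ ρ S M hM (by positivity) hr₀ X (fun e => ?_) hb
  by_cases hs : 6 * distSite (Mk (F.P K) (K - n)) e.src (iterBlockOf (K - n) x₀) * ε₁ ≤ 1 / 2
  · rw [hX e hs]
    have h := (norm_datum160_le F hnK hε₁ hU hV (iterBlockOf (K - n) x₀) e hs).1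
    have hdist : 0 ≤ distSite (Mk (F.P K) (K - n)) e.src (iterBlockOf (K - n) x₀) := distSite_nonneg _ _
    calc |φ _| ≤ ‖B27T (unitsField (toUField (Averaging.iter (fun i => BlockAveraging.blockAvg (P := F.P K) (j := i) ℰp) (K - n) U)))
          (iterBlockOf (K - n) x₀) e‖ := hφ _
      _ ≤ 6 * distSite (Mk (F.P K) (K - n)) e.src (iterBlockOf (K - n) x₀) * ε₁ := h
      _ ≤ 6 * ε₁ * (distSite (Mk (F.P K) (K - n)) e.src (iterBlockOf (K - n) x₀) + 1) := by nlinarith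
  · exact hX' e hs

end Near

end Summit.QuantumFields.YangMills.Theorems.HalvingDatum160

end
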